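import Summits.QuantumFields.YangMills.Theorems.F4SubCurvatureDoorShortRootRigidityFlatDoubleEdgeModel
import Mathlib
import HarnessLib

/-!
# LINE g20-A «angular type» (crux ⟨stmt-QuantumFields-23035⟩ `ShortRootRigidity`) — rung R-S3b `FlatDoubleEdge` BY NAME

Owner file `Cruxes/ShortRootRigidity/Lines/angular_type_rungs.lean` v3 (planner ym-idea-3 g21, sha16 a8a830bd1d79bc63).  The Prop is restated
CHARACTER-IDENTICALLY and `flatDoubleEdge_holds : FlatDoubleEdge` is derived from the model case `flatDoubleEdgeModel_holds` (this seat, file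
`…FlatDoubleEdgeModel`) by an invertible ℂ-linear change of coordinates, a translation and a dilation: with `A z = (l₁ z, l₂ z)` and its explicit
inverse `B` (Cramer; `det = l₁(e₁)l₂(e₂) − l₂(e₁)l₁(e₂) ≠ 0` from the linear independence of `l₁, l₂`), the function `w ↦ f(p + r'·Bw)`,
`r' = r/(K_B + 1)`, is a bounded holomorphic function on the model domain, and the model extension pulled back by `z ↦ r'⁻¹A(z − p)` is the
required `g` on `‖z − p‖ < δ₁ r`, `δ₁ = δ/((K_A + 1)(K_B + 1))` — depending on `l₁, l₂` only.

HONEST LABEL: one rung of the OPEN stub (C) `stub_planarSpectralCone`; R-S3d (THE step), (C), ⟨23035⟩, ⟨23125⟩, R2d and the Yang–Mills mass gap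
remain OPEN; no summit is proved by a line.  Lead seat `ym-line-sfw-p2` g75 (cell ym-idea-1, free hands).
-/

set_option autoImplicit false

noncomputable section

open MeasureTheory Filter Topology Set Metric Complex
open scoped BigOperators

namespace Summit.QuantumFields.YangMills.Theorems.F4SubCurvatureDoorFlatDoubleEdgeRegistered

open Summit.QuantumFields.YangMills.Theorems.F4SubCurvatureDoorFlatDoubleEdgeModelRegistered (flatDoubleEdgeModel_holds)

/-! ## The rung (character-identical with `Lines/angular_type_rungs.lean` v3) -/

/-- **R-S3b · FlatDoubleEdge** (target, S given R-S3a: an invertible ℂ-linear change of coordinates, a translation and a dilation): for two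
ℂ-linearly independent functionals `l₁, l₂` on `ℂ²` there is `δ₁ > 0` such that every bounded holomorphic function on
`{‖z − p‖ < r} ∩ ({Im l₁(z − p) > 0} ∪ {Im l₂(z − p) > 0})` extends holomorphically, with the same bound, to the ball `‖z − p‖ < δ₁ r` — `δ₁`
depends on `l₁, l₂` only (NOT on `p`, `r`, `f`: this uniformity is what makes the aperture gain linear in `t`).  Every real half-space through
`p` is `{Im l(z − p) > 0}` for a unique ℂ-linear `l` (`Re(λ·z) = Im(iλ·z)`); «ℂ-independent conormals» is the hypothesis. [as R-S3a] -/
def FlatDoubleEdge : Prop :=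
  ∀ (l₁ l₂ : (ℂ × ℂ) →L[ℂ] ℂ), LinearIndependent ℂ ![l₁, l₂] →
    ∃ δ₁ : ℝ, 0 < δ₁ ∧ ∀ (p : ℂ × ℂ) (r : ℝ), 0 < r → ∀ (f : ℂ × ℂ → ℂ) (M : ℝ),
      DifferentiableOn ℂ f {z : ℂ × ℂ | ‖z - p‖ < r ∧ (0 < (l₁ (z - p)).im ∨ 0 < (l₂ (z - p)).im)} →
      (∀ z : ℂ × ℂ, ‖z - p‖ < r → (0 < (l₁ (z - p)).im ∨ 0 < (l₂ (z - p)).im) → ‖f z‖ ≤ M) →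
      ∃ g : ℂ × ℂ → ℂ, DifferentiableOn ℂ g (Metric.ball p (δ₁ * r)) ∧ (∀ z ∈ Metric.ball p (δ₁ * r), ‖g z‖ ≤ M) ∧
        ∀ z ∈ Metric.ball p (δ₁ * r), (0 < (l₁ (z - p)).im ∨ 0 < (l₂ (z - p)).im) → g z = f z

/-! ## Linear algebra on `ℂ²`: coordinates of a functional, Cramer inverse -/

/-- A ℂ-linear functional on `ℂ × ℂ` in coordinates. -/
theorem clm_apply_eq (l : (ℂ × ℂ) →L[ℂ] ℂ) (z : ℂ × ℂ) : l z = z.1 * l (1, 0) + z.2 * l (0, 1) := by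
  have hz : z = z.1 • ((1 : ℂ), (0 : ℂ)) + z.2 • ((0 : ℂ), (1 : ℂ)) := by
    ext <;> simp
  conv_lhs => rw [hz]
  rw [map_add, map_smul, map_smul, smul_eq_mul, smul_eq_mul]

/-- Linear independence of two functionals forces a non-zero determinant of their coordinate matrix. -/
theorem det_ne_zero {l₁ l₂ : (ℂ × ℂ) →L[ℂ] ℂ} (h : LinearIndependent ℂ ![l₁, l₂]) :
    l₁ (1, 0) * l₂ (0, 1) - l₂ (1, 0) * l₁ (0, 1) ≠ 0 := by
  intro hD
  rw [LinearIndependent.pair_iff] at h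
  -- a vanishing combination `s l₁ + t l₂ = 0` from pointwise vanishing
  have hzero : ∀ s t : ℂ, (∀ z : ℂ × ℂ, s * l₁ z + t * l₂ z = 0) → s • l₁ + t • l₂ = 0 := by
    intro s t hst
    exact ContinuousLinearMap.ext fun z => by
      change s • l₁ z + t • l₂ z = 0
      rw [smul_eq_mul, smul_eq_mul]; exact hst z
  by_cases hb : l₁ (0, 1) = 0 ∧ l₂ (0, 1) = 0
  · obtain ⟨hb1, hb2⟩ := hb
    by_cases ha : l₁ (1, 0) = 0 ∧ l₂ (1, 0) = 0
    · -- then `l₁ = 0`: the combination `1 • l₁ + 0 • l₂` vanishes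
      have h10 := (h 1 0 (hzero 1 0 fun z => by rw [clm_apply_eq l₁ z, ha.1, hb1]; ring)).1
      exact one_ne_zero h10
    · -- `a₂ l₁ − a₁ l₂ = 0`
      obtain ⟨h1, h2⟩ := h (l₂ (1, 0)) (-l₁ (1, 0)) (hzero _ _ fun z => by
        rw [clm_apply_eq l₁ z, clm_apply_eq l₂ z, hb1, hb2]; ring)
      exact ha ⟨neg_eq_zero.1 h2, h1⟩
  · -- `b₂ l₁ − b₁ l₂ = 0`
    obtain ⟨h1, h2⟩ := h (l₂ (0, 1)) (-l₁ (0, 1)) (hzero _ _ fun z => by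
      rw [clm_apply_eq l₁ z, clm_apply_eq l₂ z]
      linear_combination z.1 * hD)
    exact hb ⟨neg_eq_zero.1 h2, h1⟩

/-! ## The coordinate map `A = (l₁, l₂)` and its Cramer inverse `B` -/

section Coordinates

variable (l₁ l₂ : (ℂ × ℂ) →L[ℂ] ℂ)

/-- `A z = (l₁ z, l₂ z)`. -/
def Amap (z : ℂ × ℂ) : ℂ × ℂ := (l₁ z, l₂ z)

/-- The determinant of the coordinate matrix of `(l₁, l₂)`. -/
def detA : ℂ := l₁ (1, 0) * l₂ (0, 1) - l₂ (1, 0) * l₁ (0, 1)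

/-- Cramer's inverse of `A`. -/
def Bmap (w : ℂ × ℂ) : ℂ × ℂ :=
  ((l₂ (0, 1) * w.1 - l₁ (0, 1) * w.2) * (detA l₁ l₂)⁻¹, (-l₂ (1, 0) * w.1 + l₁ (1, 0) * w.2) * (detA l₁ l₂)⁻¹)

/-- `A` is holomorphic (it is ℂ-linear). -/
theorem differentiable_Amap : Differentiable ℂ (Amap l₁ l₂) :=
  (l₁.differentiable).prodMk l₂.differentiable

/-- `B` is holomorphic (it is ℂ-linear). -/
theorem differentiable_Bmap : Differentiable ℂ (Bmap l₁ l₂) := by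
  unfold Bmap; fun_prop

/-- `B` commutes with scalars. -/
theorem Bmap_smul (c : ℂ) (w : ℂ × ℂ) : Bmap l₁ l₂ (c • w) = c • Bmap l₁ l₂ w := by
  ext <;> simp [Bmap] <;> ring

/-- `A` after a scalar. -/
theorem Amap_smul (c : ℂ) (z : ℂ × ℂ) : Amap l₁ l₂ (c • z) = c • Amap l₁ l₂ z := by
  ext <;> simp [Amap]

variable {l₁ l₂}

/-- `l₁ ∘ B = pr₁`. -/
theorem l₁_Bmap (hD : detA l₁ l₂ ≠ 0) (w : ℂ × ℂ) : l₁ (Bmap l₁ l₂ w) = w.1 := by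
  rw [clm_apply_eq l₁]
  simp only [Bmap]
  field_simp
  unfold detA
  ring

/-- `l₂ ∘ B = pr₂`. -/
theorem l₂_Bmap (hD : detA l₁ l₂ ≠ 0) (w : ℂ × ℂ) : l₂ (Bmap l₁ l₂ w) = w.2 := by
  rw [clm_apply_eq l₂]
  simp only [Bmap]
  field_simp
  unfold detA
  ring

/-- `B ∘ A = id`. -/
theorem Bmap_Amap (hD : detA l₁ l₂ ≠ 0) (z : ℂ × ℂ) : Bmap l₁ l₂ (Amap l₁ l₂ z) = z := by
  ext
  · simp only [Bmap, Amap]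
    rw [clm_apply_eq l₁ z, clm_apply_eq l₂ z]
    field_simp
    unfold detA
    ring
  · simp only [Bmap, Amap]
    rw [clm_apply_eq l₁ z, clm_apply_eq l₂ z]
    field_simp
    unfold detA
    ring

/-- Norm control of `A` (sup norm). -/
theorem norm_Amap_le (z : ℂ × ℂ) : ‖Amap l₁ l₂ z‖ ≤ (‖l₁‖ + ‖l₂‖) * ‖z‖ := by
  rw [Amap, Prod.norm_def]
  refine max_le ?_ ?_
  · calc ‖l₁ z‖ ≤ ‖l₁‖ * ‖z‖ := l₁.le_opNorm z
      _ ≤ (‖l₁‖ + ‖l₂‖) * ‖z‖ := by gcongr; linarith [norm_nonneg l₂]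
  · calc ‖l₂ z‖ ≤ ‖l₂‖ * ‖z‖ := l₂.le_opNorm z
      _ ≤ (‖l₁‖ + ‖l₂‖) * ‖z‖ := by gcongr; linarith [norm_nonneg l₁]

/-- The constant of the inverse. -/
def KB (l₁ l₂ : (ℂ × ℂ) →L[ℂ] ℂ) : ℝ :=
  (‖l₁ (1, 0)‖ + ‖l₁ (0, 1)‖ + ‖l₂ (1, 0)‖ + ‖l₂ (0, 1)‖) * ‖detA l₁ l₂‖⁻¹

/-- The constant of the inverse is non-negative. -/
theorem KB_nonneg : 0 ≤ KB l₁ l₂ := by unfold KB; positivity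

/-- Norm control of `B` (sup norm). -/
theorem norm_Bmap_le (w : ℂ × ℂ) : ‖Bmap l₁ l₂ w‖ ≤ KB l₁ l₂ * ‖w‖ := by
  have h1 : ‖w.1‖ ≤ ‖w‖ := norm_fst_le w
  have h2 : ‖w.2‖ ≤ ‖w‖ := norm_snd_le w
  have hDi : 0 ≤ ‖detA l₁ l₂‖⁻¹ := by positivity
  have hw : 0 ≤ ‖w‖ := norm_nonneg w
  rw [Bmap, Prod.norm_def, KB]
  refine max_le ?_ ?_
  · rw [norm_mul, norm_inv]
    have : ‖l₂ (0, 1) * w.1 - l₁ (0, 1) * w.2‖ ≤ (‖l₂ (0, 1)‖ + ‖l₁ (0, 1)‖) * ‖w‖ := by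
      calc ‖l₂ (0, 1) * w.1 - l₁ (0, 1) * w.2‖ ≤ ‖l₂ (0, 1) * w.1‖ + ‖l₁ (0, 1) * w.2‖ := norm_sub_le _ _
        _ = ‖l₂ (0, 1)‖ * ‖w.1‖ + ‖l₁ (0, 1)‖ * ‖w.2‖ := by rw [norm_mul, norm_mul]
        _ ≤ ‖l₂ (0, 1)‖ * ‖w‖ + ‖l₁ (0, 1)‖ * ‖w‖ := by gcongr
        _ = (‖l₂ (0, 1)‖ + ‖l₁ (0, 1)‖) * ‖w‖ := by ring
    calc ‖l₂ (0, 1) * w.1 - l₁ (0, 1) * w.2‖ * ‖detA l₁ l₂‖⁻¹ ≤ (‖l₂ (0, 1)‖ + ‖l₁ (0, 1)‖) * ‖w‖ * ‖detA l₁ l₂‖⁻¹ := by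
          gcongr
      _ ≤ (‖l₁ (1, 0)‖ + ‖l₁ (0, 1)‖ + ‖l₂ (1, 0)‖ + ‖l₂ (0, 1)‖) * ‖detA l₁ l₂‖⁻¹ * ‖w‖ := by
          nlinarith [norm_nonneg (l₁ (1, 0)), norm_nonneg (l₂ (1, 0)), mul_nonneg hw hDi]
  · rw [norm_mul, norm_inv]
    have : ‖-l₂ (1, 0) * w.1 + l₁ (1, 0) * w.2‖ ≤ (‖l₂ (1, 0)‖ + ‖l₁ (1, 0)‖) * ‖w‖ := by
      calc ‖-l₂ (1, 0) * w.1 + l₁ (1, 0) * w.2‖ ≤ ‖-l₂ (1, 0) * w.1‖ + ‖l₁ (1, 0) * w.2‖ := norm_add_le _ _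
        _ = ‖l₂ (1, 0)‖ * ‖w.1‖ + ‖l₁ (1, 0)‖ * ‖w.2‖ := by rw [norm_mul, norm_mul, norm_neg]
        _ ≤ ‖l₂ (1, 0)‖ * ‖w‖ + ‖l₁ (1, 0)‖ * ‖w‖ := by gcongr
        _ = (‖l₂ (1, 0)‖ + ‖l₁ (1, 0)‖) * ‖w‖ := by ring
    calc ‖-l₂ (1, 0) * w.1 + l₁ (1, 0) * w.2‖ * ‖detA l₁ l₂‖⁻¹ ≤ (‖l₂ (1, 0)‖ + ‖l₁ (1, 0)‖) * ‖w‖ * ‖detA l₁ l₂‖⁻¹ := by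
          gcongr
      _ ≤ (‖l₁ (1, 0)‖ + ‖l₁ (0, 1)‖ + ‖l₂ (1, 0)‖ + ‖l₂ (0, 1)‖) * ‖detA l₁ l₂‖⁻¹ * ‖w‖ := by
          nlinarith [norm_nonneg (l₁ (0, 1)), norm_nonneg (l₂ (0, 1)), mul_nonneg hw hDi]

end Coordinates

/-! ## The rung -/

/-- Imaginary part after a real scaling. -/
theorem im_ofReal_mul_pos {a : ℝ} (ha : 0 < a) {z : ℂ} : 0 < ((a : ℂ) * z).im ↔ 0 < z.im := by
  rw [Complex.im_ofReal_mul]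
  exact ⟨fun h => pos_of_mul_pos_right h ha.le |> fun h' => by nlinarith [h, ha], fun h => mul_pos ha h⟩

/-- **RUNG R-S3b (by name): `FlatDoubleEdge`** — from the model case by the affine change of coordinates `w = r'⁻¹ A (z − p)`. -/
theorem flatDoubleEdge_holds : FlatDoubleEdge := by
  intro l₁ l₂ hli
  obtain ⟨δ, hδ, hmodel⟩ := flatDoubleEdgeModel_holds
  have hD : detA l₁ l₂ ≠ 0 := det_ne_zero hli
  set KA : ℝ := ‖l₁‖ + ‖l₂‖ with hKA
  have hKA0 : 0 ≤ KA := by positivity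
  have hKB0 : 0 ≤ KB l₁ l₂ := KB_nonneg
  refine ⟨δ / ((KA + 1) * (KB l₁ l₂ + 1)), by positivity, fun p r hr f M hf hM => ?_⟩
  -- the dilation
  set r' : ℝ := r / (KB l₁ l₂ + 1) with hr'
  have hr'0 : 0 < r' := by positivity
  have hr'KB : r' * (KB l₁ l₂ + 1) = r := by rw [hr']; field_simp
  -- the model function `w ↦ f(p + r' B w)`
  set Φ : ℂ × ℂ → ℂ × ℂ := fun w => p + (r' : ℂ) • Bmap l₁ l₂ w with hΦ
  have hΦ_diff : Differentiable ℂ Φ := by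
    have hB := differentiable_Bmap l₁ l₂
    rw [hΦ]; fun_prop
  have hΦ_sub : ∀ w, Φ w - p = (r' : ℂ) • Bmap l₁ l₂ w := fun w => by simp [hΦ]
  have hmap : ∀ w : ℂ × ℂ, ‖w‖ < 1 → (0 < w.1.im ∨ 0 < w.2.im) →
      ‖Φ w - p‖ < r ∧ (0 < (l₁ (Φ w - p)).im ∨ 0 < (l₂ (Φ w - p)).im) := by
    intro w hw hor
    rw [hΦ_sub]
    constructor
    · rw [norm_smul, Complex.norm_real, Real.norm_eq_abs, abs_of_pos hr'0]
      calc r' * ‖Bmap l₁ l₂ w‖ ≤ r' * (KB l₁ l₂ * ‖w‖) := by gcongr; exact norm_Bmap_le w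
        _ ≤ r' * (KB l₁ l₂ * 1) := by gcongr
        _ < r' * (KB l₁ l₂ + 1) := by nlinarith
        _ = r := hr'KB
    · rw [map_smul, map_smul, smul_eq_mul, smul_eq_mul, l₁_Bmap hD, l₂_Bmap hD, im_ofReal_mul_pos hr'0,
        im_ofReal_mul_pos hr'0]
      exact hor
  have hft_diff : DifferentiableOn ℂ (fun w => f (Φ w)) {w : ℂ × ℂ | ‖w‖ < 1 ∧ (0 < w.1.im ∨ 0 < w.2.im)} :=
    hf.comp hΦ_diff.differentiableOn fun w hw => hmap w hw.1 hw.2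
  have hft_bd : ∀ w : ℂ × ℂ, ‖w‖ < 1 → (0 < w.1.im ∨ 0 < w.2.im) → ‖f (Φ w)‖ ≤ M := fun w hw hor =>
    hM _ (hmap w hw hor).1 (hmap w hw hor).2
  obtain ⟨g₀, hg₀d, hg₀b, hg₀eq⟩ := hmodel (fun w => f (Φ w)) M hft_diff hft_bd
  -- pull back by `T z = r'⁻¹ A (z − p)`
  set T : ℂ × ℂ → ℂ × ℂ := fun z => ((r'⁻¹ : ℝ) : ℂ) • Amap l₁ l₂ (z - p) with hT
  have hT_diff : Differentiable ℂ T := by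
    have hA := differentiable_Amap l₁ l₂
    rw [hT]; fun_prop
  have hT_ball : ∀ z : ℂ × ℂ, z ∈ Metric.ball p (δ / ((KA + 1) * (KB l₁ l₂ + 1)) * r) → T z ∈ Metric.ball (0 : ℂ × ℂ) δ := by
    intro z hz
    rw [Metric.mem_ball, dist_eq_norm] at hz
    rw [mem_ball_zero_iff, hT]
    dsimp only
    rw [norm_smul, Complex.norm_real, Real.norm_eq_abs, abs_of_pos (inv_pos.2 hr'0)]
    have h1 : ‖Amap l₁ l₂ (z - p)‖ ≤ KA * ‖z - p‖ := norm_Amap_le (z - p)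
    have h2 : r'⁻¹ * (KA * ‖z - p‖) ≤ r'⁻¹ * (KA * (δ / ((KA + 1) * (KB l₁ l₂ + 1)) * r)) := by
      gcongr
    have h3 : r'⁻¹ * (KA * (δ / ((KA + 1) * (KB l₁ l₂ + 1)) * r)) = KA / (KA + 1) * δ := by
      rw [hr']; field_simp
    have h4 : KA / (KA + 1) * δ < δ := by
      have : KA / (KA + 1) < 1 := by rw [div_lt_one (by positivity)]; linarith
      nlinarith
    calc r'⁻¹ * ‖Amap l₁ l₂ (z - p)‖ ≤ r'⁻¹ * (KA * ‖z - p‖) := by gcongr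
      _ ≤ r'⁻¹ * (KA * (δ / ((KA + 1) * (KB l₁ l₂ + 1)) * r)) := h2
      _ = KA / (KA + 1) * δ := h3
      _ < δ := h4
  refine ⟨fun z => g₀ (T z), hg₀d.comp hT_diff.differentiableOn fun z hz => hT_ball z hz,
    fun z hz => hg₀b _ (hT_ball z hz), fun z hz hor => ?_⟩
  -- agreement
  have hTor : 0 < (T z).1.im ∨ 0 < (T z).2.im := by
    have e1 : (T z).1 = ((r'⁻¹ : ℝ) : ℂ) * l₁ (z - p) := by simp [hT, Amap]
    have e2 : (T z).2 = ((r'⁻¹ : ℝ) : ℂ) * l₂ (z - p) := by simp [hT, Amap]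
    rw [e1, e2, im_ofReal_mul_pos (inv_pos.2 hr'0), im_ofReal_mul_pos (inv_pos.2 hr'0)]
    exact hor
  show g₀ (T z) = f z
  rw [hg₀eq (T z) (hT_ball z hz) hTor]
  show f (Φ (T z)) = f z
  congr 1
  simp only [hΦ, hT]
  rw [Bmap_smul, smul_smul, ← Complex.ofReal_mul, mul_inv_cancel₀ hr'0.ne', Complex.ofReal_one, one_smul, Bmap_Amap hD]
  abel

end Summit.QuantumFields.YangMills.Theorems.F4SubCurvatureDoorFlatDoubleEdgeRegistered

end
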